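import Mathlib.Algebra.Polynomial.Roots
import Literature.AlgebraicGeometry.Frobenioids.ArchimedeanFrobeniusAmple
import Literature.AlgebraicGeometry.Frobenioids.ArchimedeanUnitCircle
import HarnessLib

/-!
# Frobenioids II, Example 3.3 (v): tools for slit morphisms (arcs, good directions, region-bijective arrows)

Mochizuki, *The geometry of Frobenioids II: poly-Frobenioids*, Kyushu J. Math. **62** (2008)
401–460, §3, Example 3.3 (v), author's text p. 29 [cite: MochizukiFrdII2008, Ex 3.3 (v) p.29]
("slit morphisms … are FSMI-morphisms").

Toolkit for the proof (`ArchimedeanSlitCore.lean`, `ArchimedeanSlitMorphisms.lean`):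
* `D₀`: objects isomorphic to `Spec ℂ` are `Spec ℂ`; arrows `Spec ℂ → Spec ℂ` are isos (objects mapping to
  `Spec ℂ` are `Spec ℂ`: abc-iut-L1-t9's `D0.isComplex_of_hom`, `ArchimedeanUnitCircle.lean`);
* arcs: products and powers of small arcs (`mul_mem_arcDir_mul`, `pow_subset_arcDir_pow`, additivity
  of `arg`), arcs are infinite, and a nonempty open subset of `S¹` contains a direction whose `d`-th
  power avoids two prescribed values (`exists_mem_pow_ne`: the bad directions are roots, a finite set);
* `C₀`: a LINEAR arrow with invertible base whose scalar maps the angular region ONTO the pulled-back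
  region of the target is an isomorphism (`C0.isIso_of_smul_carrier_eq`).
-/

namespace Literature.AlgebraicGeometry.Frobenioids

open CategoryTheory Complex
open scoped Pointwise

noncomputable section

namespace ArchFrd

/-! ### `D₀` around `Spec ℂ` -/

/-- An object isomorphic to `Spec ℂ` (via an arrow out of `Spec ℂ`) is `Spec ℂ` (`Spec ℂ → Spec ℝ` is
not a monomorphism). [cite: MochizukiFrdII2008, Def 3.1 (i) p.23] -/
theorem D0.isComplex_of_iso {K L : D0} (b : K ⟶ L) [IsIso b] (hK : K.IsComplex) : L.IsComplex := by
  cases K with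
  | real => exact absurd hK (by decide)
  | complex =>
    cases L with
    | complex => rfl
    | real =>
      have h := D0.not_mono_toRealHom
      rw [← D0.hom_complex_real_eq b] at h
      exact absurd (inferInstance : Mono b) h

/-- Every arrow between complex objects of `D₀` is an isomorphism (`Gal(ℂ/ℝ)`).
[cite: MochizukiFrdII2008, Def 3.1 (i) p.23] -/
theorem D0.isIso_of_isComplex {K L : D0} (f : K ⟶ L) (hK : K.IsComplex) (hL : L.IsComplex) :
    IsIso f := by
  cases K with
  | real => exact absurd hK (by decide)
  | complex =>
    cases L with
    | real => exact absurd hL (by decide)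
    | complex =>
      rcases D0.hom_complex_complex_eq f with h | h
      · rw [h]; infer_instance
      · rw [h]; exact ⟨⟨D0.conj, D0.conj_comp_conj, D0.conj_comp_conj⟩⟩

/-! ### Arcs: products, powers, infinitude, good directions -/

/-- Products of points of arcs: half-widths add (additivity of `arg` below `π`).
[cite: MochizukiFrdII2008, Def 3.1 (iii) p.24] -/
theorem mul_mem_arcDir_mul {a b : ℝ} {w₁ w₂ z₁ z₂ : normOneSubgroup ℂ} (h₁ : z₁ ∈ arcDir w₁ a)
    (h₂ : z₂ ∈ arcDir w₂ b) (hab : a + b ≤ Real.pi) : z₁ * z₂ ∈ arcDir (w₁ * w₂) (a + b) := by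
  change arg (((z₁ * z₂ * (w₁ * w₂)⁻¹ : normOneSubgroup ℂ) : ℂˣ) : ℂ) ∈ Set.Ioo (-(a + b)) (a + b)
  have h₁' : arg (((z₁ * w₁⁻¹ : normOneSubgroup ℂ) : ℂˣ) : ℂ) ∈ Set.Ioo (-a) a := h₁
  have h₂' : arg (((z₂ * w₂⁻¹ : normOneSubgroup ℂ) : ℂˣ) : ℂ) ∈ Set.Ioo (-b) b := h₂
  have e : z₁ * z₂ * (w₁ * w₂)⁻¹ = (z₁ * w₁⁻¹) * (z₂ * w₂⁻¹) := by
    rw [mul_inv, mul_mul_mul_comm]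
  rw [e, Subgroup.coe_mul, Units.val_mul,
    (Complex.arg_mul_eq_add_arg_iff (Units.ne_zero _) (Units.ne_zero _)).mpr
      ⟨by linarith [h₁'.1, h₂'.1], by linarith [h₁'.2, h₂'.2]⟩]
  exact ⟨by linarith [h₁'.1, h₂'.1], by linarith [h₁'.2, h₂'.2]⟩

/-- Powers of an arc: `(arcDir w ε)^{n+1} ⊆ arcDir (w^{n+1}) ((n+1) ε)` while `(n+1) ε ≤ π`.
[cite: MochizukiFrdII2008, Def 3.1 (iii) p.24] -/
theorem pow_subset_arcDir_pow (w : normOneSubgroup ℂ) {ε : ℝ} (hε : 0 ≤ ε) :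
    ∀ n : ℕ, ((n : ℝ) + 1) * ε ≤ Real.pi →
      arcDir w ε ^ (n + 1) ⊆ arcDir (w ^ (n + 1)) (((n : ℝ) + 1) * ε) := by
  intro n
  induction n with
  | zero =>
    intro _
    rw [zero_add, pow_one, pow_one, Nat.cast_zero, zero_add, one_mul]
  | succ n ih =>
    intro h
    have h' : ((n : ℝ) + 1) * ε ≤ Real.pi := by push_cast at h; nlinarith
    rw [pow_succ, pow_succ w (n + 1)]
    intro x hx
    obtain ⟨y, hy, z, hz, rfl⟩ := Set.mem_mul.mp hx
    have hyz := mul_mem_arcDir_mul (ih h' hy) hz (by push_cast at h; linarith)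
    have e : ((n : ℝ) + 1) * ε + ε = (((n + 1 : ℕ) : ℝ) + 1) * ε := by push_cast; ring
    rwa [e] at hyz

/-- An arc of positive half-width `< π` is infinite. [cite: MochizukiFrdII2008, Def 3.1 (iii) p.24] -/
theorem arcDir_infinite (w : normOneSubgroup ℂ) {ε : ℝ} (hε : 0 < ε) (hεπ : ε < Real.pi) :
    (arcDir w ε).Infinite := by
  rw [arcDir_eq_image w hεπ]
  refine (Set.Ioo_infinite (by linarith : -ε < ε)).image ?_
  intro θ₁ h₁ θ₂ h₂ heq
  have e₁ := relArg_mul_expUnit w (θ := θ₁) ⟨by linarith [h₁.1], by linarith [h₁.2]⟩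
  have e₂ := relArg_mul_expUnit w (θ := θ₂) ⟨by linarith [h₂.1], by linarith [h₂.2]⟩
  have heq' : w * expUnit θ₁ = w * expUnit θ₂ := heq
  rw [← e₁, ← e₂, heq']

/-- The directions of `S¹` whose `d`-th power is a given value form a finite set (roots of `X^d − v`).
[cite: MochizukiFrdII2008, Lem 3.2 p.25] -/
theorem finite_setOf_pow_eq {d : ℕ} (hd : 0 < d) (v : normOneSubgroup ℂ) :
    {u : normOneSubgroup ℂ | u ^ d = v}.Finite := by
  have hfin : {x : ℂ | x ^ d = ((v : ℂˣ) : ℂ)}.Finite := by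
    refine (Polynomial.nthRoots d ((v : ℂˣ) : ℂ)).toFinset.finite_toSet.subset ?_
    intro x hx
    rw [Finset.mem_coe, Multiset.mem_toFinset, Polynomial.mem_nthRoots hd]
    exact hx
  have hinj : Set.InjOn (fun u : normOneSubgroup ℂ => ((u : ℂˣ) : ℂ))
      ((fun u : normOneSubgroup ℂ => ((u : ℂˣ) : ℂ)) ⁻¹' {x : ℂ | x ^ d = ((v : ℂˣ) : ℂ)}) :=
    fun u₁ _ u₂ _ h => Subtype.ext (Units.ext h)
  refine (hfin.preimage hinj).subset ?_
  intro u hu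
  change ((u : ℂˣ) : ℂ) ^ d = ((v : ℂˣ) : ℂ)
  have := congrArg (fun z : normOneSubgroup ℂ => ((z : ℂˣ) : ℂ)) hu
  simpa only [Subgroup.coe_pow, Units.val_pow_eq_pow_val] using this

/-- A nonempty open subset of `S¹` contains a direction whose `d`-th power avoids two prescribed values
(open sets of `S¹` are infinite, the bad directions finite). [cite: MochizukiFrdII2008, Lem 3.2 p.25] -/
theorem exists_mem_pow_ne {U : Set (normOneSubgroup ℂ)} (hU : IsOpen U) (hne : U.Nonempty) {d : ℕ}
    (hd : 0 < d) (v₁ v₂ : normOneSubgroup ℂ) : ∃ w ∈ U, w ^ d ≠ v₁ ∧ w ^ d ≠ v₂ := by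
  obtain ⟨u, hu⟩ := hne
  obtain ⟨ε, hε, hεπ, hsub⟩ := exists_arcDir_subset hU hu
  have hinf : (U \ ({u : normOneSubgroup ℂ | u ^ d = v₁} ∪ {u | u ^ d = v₂})).Infinite :=
    ((arcDir_infinite u hε hεπ).mono hsub).sdiff
      ((finite_setOf_pow_eq hd v₁).union (finite_setOf_pow_eq hd v₂))
  obtain ⟨w, hwU, hw⟩ := hinf.nonempty
  exact ⟨w, hwU, fun h => hw (Or.inl h), fun h => hw (Or.inr h)⟩

/-- `u ↦ c · u^d` is continuous on `S¹`. [cite: MochizukiFrdII2008, Lem 3.2 p.25] -/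
theorem continuous_mul_pow (c : normOneSubgroup ℂ) (d : ℕ) :
    Continuous fun u : normOneSubgroup ℂ => c * u ^ d :=
  continuous_const.mul (continuous_pow d)

/-! ### `C₀`: region-bijective linear arrows are isomorphisms -/

namespace C0

variable {X Y : C0}

/-- A LINEAR arrow `ψ = (b, 1, c)` of `C₀` with `b` invertible and `c · A_X = A_Y|_b` (the scalar maps
the region ONTO the pulled-back region) is an isomorphism, with inverse `(b⁻¹, 1, b(c⁻¹))`.
[cite: MochizukiFrdII2008, Ex 3.3 (i) p.27] -/
theorem isIso_of_smul_carrier_eq (ψ : X ⟶ Y) [IsIso (Base ψ)] (hdeg : degFr ψ = 1)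
    (hreg : scalar ψ • X.region.carrier = pullRegion Y (Base ψ)) : IsIso ψ := by
  let g : Y ⟶ X :=
    { base := inv (Base ψ)
      degFr := 1
      scalar := (Base ψ).act (scalar ψ)⁻¹
      scalar_mem := D0.act_inv_mem_scalars _ ψ.scalar_mem
      mapsTo := by
        rw [PNat.one_coe, pow_one]
        change _ ⊆ (inv (Base ψ)).act '' X.region.carrier
        unfold D0.Hom.act
        rw [D0.twists_inv]
        rintro _ ⟨y, hy, rfl⟩
        have hy' : D0.galAct (D0.Hom.twists (Base ψ)) y ∈ pullRegion Y (Base ψ) := ⟨y, hy, rfl⟩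
        rw [← hreg] at hy'
        obtain ⟨x, hx, hxe⟩ := hy'
        refine ⟨x, hx, ?_⟩
        have hx' : x = (scalar ψ)⁻¹ * D0.galAct (D0.Hom.twists (Base ψ)) y := by
          rw [eq_inv_mul_iff_mul_eq, ← smul_eq_mul]; exact hxe
        change D0.galAct _ x = D0.galAct (D0.Hom.twists (Base ψ)) (scalar ψ)⁻¹ • y
        rw [hx', map_mul, D0.galAct_galAct, smul_eq_mul] }
  refine ⟨⟨g, ?_, ?_⟩⟩
  · refine hom_ext ?_ ?_ ?_
    · change Base ψ ≫ inv (Base ψ) = 𝟙 _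
      exact IsIso.hom_inv_id _
    · change degFr ψ * 1 = 1
      rw [hdeg]; rfl
    · change (Base ψ).act ((Base ψ).act (scalar ψ)⁻¹) * scalar ψ ^ ((1 : ℕ+) : ℕ) = 1
      unfold D0.Hom.act
      rw [D0.galAct_galAct, PNat.one_coe, pow_one, inv_mul_cancel]
  · refine hom_ext ?_ ?_ ?_
    · change inv (Base ψ) ≫ Base ψ = 𝟙 _
      exact IsIso.inv_hom_id _
    · change 1 * degFr ψ = 1
      rw [hdeg]; rfl
    · change (inv (Base ψ)).act (scalar ψ) * ((Base ψ).act (scalar ψ)⁻¹) ^ (degFr ψ : ℕ) = 1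
      unfold D0.Hom.act
      rw [D0.twists_inv, hdeg, PNat.one_coe, pow_one, ← map_mul, mul_inv_cancel, map_one]

end C0

end ArchFrd

end

end Literature.AlgebraicGeometry.Frobenioids
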